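import Literature.NumberTheory.ComplexMultiplication.IrreducibleOddWeightsRightIdeals
import HarnessLib

/-!
# Right ideals, I b: free slots — the matrix-coefficient space is the RIGHT ideal `u·ℚ[G]`, the rank module is the LEFT
# ideal `ℚ[G]·u`; `dim Hg(∏_i A_i) = dim Σ_i u_iℚ[G] = dim Σ_i U(Φ_i⁻¹)` (the reflex reading)

COR-CM (cell `pub-hodgecm2`, binder seat `b16` gen 64, count-neutral claim RIGHT IDEALS, file R1b — abstract level, a
finite group `G` acting on itself; theorems only, no definition, no named fact, no `sorry`).  NEW as stated, hence under
`Summits/`.  HONEST FRAMING: finite-dimensional linear algebra about the Kubota–Dodson rank of a family of CM types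
(`dim Hg(∏_i A_i)` versus `Σ_i dim Hg(A_i)`); `HC_CM` is neither used nor asserted.

SETTING of file R1 (`IrreducibleOddWeightsRightIdeals`): `dim U(Σ) = dim ⨆_i MC_i`, the matrix-coefficient spaces
`MC_i = span{g ↦ u_i(g·x) : x ∈ E_i} ≤ ℚ^G`.  Here the slots are FREE: `G` finite acting on itself by left translation,
types `Ψ_i ⊆ G` — ONE Galois CM field `K` with `G = Gal(K/ℚ)` and `Hom(K, ℂ)` a `G`-torsor, or the GALOIS MODEL of an
arbitrary family (`Literature/…/CMTypeRankFamiliesPullback`, `…/AbelianCMFamilyRankCharacters`: every family of CM fields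
inside a Galois field `L` is a family of types `Ψ_i = {g | ι∘g∘e_i ∈ Φ_i}` of `Gal(L/ℚ)`).

* **`finrank_span_leftTranslates_eq_finrank_span_rightTranslates`** — `dim ℚ[G]·f = dim f·ℚ[G]` for every `f ∈ ℚ^G`
  (row and column space of `(h, g) ↦ f(hg)`); [Ribet1980, (3.3)] "rank = rank of the dual" for a type vector.
* **`finrank_antiSpan_sigmaType_eq_finrank_iSup_span_rightTranslates`** — the matrix coefficient `c_{i,δ}(g) = u_i(gδ)`
  is the RIGHT translate, so **`dim Hg(∏_i A_i) = dim Σ_i u_iℚ[G]`**, the SUM of the RIGHT ideals generated by the type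
  vectors, while `dim Hg(A_i) = dim ℚ[G]u_i = dim u_iℚ[G]` (`finrank_antiSpan_eq_finrank_span_rightTranslates`): the
  family is additive iff the right ideals `u_iℚ[G]` are INDEPENDENT (R1 `typeRank_sigmaType_add_card_eq_iff_iSupIndep`)
  — which is why the same-field criteria of `IrreducibleOddWeightsShadowIdealsSameField` (gen 63) are stated with right
  ideals although each rank is a left ideal.
* **`finrank_antiSpan_sigmaType_eq_finrank_iSup_antiSpan_inv`** — THE REFLEX READING: inversion `g ↦ g⁻¹` (a linear
  automorphism of `ℚ^G`) carries `u_iℚ[G]` onto the translate module `U(Ψ_i⁻¹)` of the INVERSE type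
  `Ψ_i⁻¹ = {g⁻¹ : g ∈ Ψ_i}` (for a Galois CM field: the reflex type lifted to the field, [Ribet1980, (3.1)]), so
  **`dim Hg(∏_i A_i) = dim Σ_i U(Ψ_i⁻¹)`** — the rank of the FAMILY is the dimension of the SUM, inside the ONE slot
  `ℚ^G`, of the translate modules of the inverse types (one type: `finrank_antiSpan_eq_finrank_antiSpan_inv`,
  `rank Ψ = rank Ψ⁻¹`, the tree's `typeRank_reflexType_eq` in free-slot form).

## References

* [Ribet1980] K. A. Ribet, *Division fields of abelian varieties with complex multiplication*, Mém. SMF 2 (1980), §3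
  (3.1)–(3.3).
* [Deligne1982HodgeCycles] P. Deligne, *Hodge cycles on abelian varieties*, LNM 900 (1982), I.5 (p. 53), I Ex. 3.7.
* [Kubota1965] T. Kubota, *On the field extension by complex multiplication*, Trans. AMS 118 (1965), §2 Lemma 1–2.

Provenance: Literature home (namespace `Literature.NumberTheory.ComplexMultiplication.IrrOdd`) of the Summits-side `CorCM/IrreducibleOddWeightsRightIdealsFree` (cell `pub-hodgecm2`, COR-CM; all its imports are `Literature/`, Mathlib and the already re-homed `IrreducibleOddWeightsRightIdeals`), which `Literature/` may not import; theorems only, no named fact, no definition. Nothing here bears on `HC_CM`. Lane `lit-hodgefound` (Layer A3: CM types, their Kubota ranks and Galois combinatorics), seat p20.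
-/

set_option autoImplicit false

noncomputable section

open scoped BigOperators Pointwise

universe u v w

namespace Literature.NumberTheory.ComplexMultiplication.IrrOdd

open Literature.NumberTheory.ComplexMultiplication

/-! ### Free slots: matrix-coefficient spaces are RIGHT ideals; the reflex reading -/

section Free

variable {G : Type w} [Group G] [Fintype G]

/-- **`dim ℚ[G]·f = dim f·ℚ[G]`**: for every `f ∈ ℚ^G` the LEFT translates `g ↦ f(hg)` and the RIGHT translates
`g ↦ f(gδ)` span spaces of the same dimension (row and column space of `(h, g) ↦ f(hg)`). [cite: Ribet1980, §3 (3.3)] -/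
theorem finrank_span_leftTranslates_eq_finrank_span_rightTranslates (f : G → ℚ) :
    Module.finrank ℚ (Submodule.span ℚ (Set.range fun h : G => fun g : G => f (h * g))) =
      Module.finrank ℚ (Submodule.span ℚ (Set.range fun δ : G => fun g : G => f (g * δ))) :=
  finrank_span_range_eq_finrank_span_range_swap (fun (h : G) (g : G) => f (h * g))

omit [Fintype G] in
/-- On a free slot the coefficient space is the span of the RIGHT translates `g ↦ u_1(gδ)` of the type vector (the
right ideal `u_1(Ψ)·ℚ[G]`): `c_δ(g) = u_g(δ) = u_1(gδ)`. [cite: Kubota1965, §2 Lemma 1] -/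
theorem span_coeff_eq_span_rightTranslates (Ψ : Set G) :
    Submodule.span ℚ (Set.range fun δ : G => fun g : G => antiVec Ψ g δ) =
      Submodule.span ℚ (Set.range fun δ : G => fun g : G => antiVec Ψ (1 : G) (g * δ)) := by
  congr 1
  ext c
  simp only [Set.mem_range]
  constructor
  · rintro ⟨δ, rfl⟩
    exact ⟨δ, funext fun g => by rw [antiVec_apply_eq_antiVec_one_smul Ψ g δ, smul_eq_mul]⟩
  · rintro ⟨δ, rfl⟩
    exact ⟨δ, funext fun g => by rw [antiVec_apply_eq_antiVec_one_smul Ψ g δ, smul_eq_mul]⟩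

variable {I : Type u} [Fintype I]

/-- **`dim Hg(∏_i A_i) = dim Σ_i u_iℚ[G]`** for a family of FREE slots (types `Ψ_i ⊆ G` of the group acting on itself —
one Galois CM field, or the Galois model of any family): the translate module of the family type has the dimension of the
SUM of the RIGHT ideals `u_iℚ[G] = span{g ↦ u_i(gδ) : δ ∈ G}`, `u_i = u_1(Ψ_i)`; whereas `dim Hg(A_i) = dim ℚ[G]u_i =
dim u_iℚ[G]`.  So the family is additive iff the right ideals `u_iℚ[G]` are independent.
[cite: Deligne1982HodgeCycles, I.5 (p. 53) and I Ex. 3.7 (c)] [cite: Kubota1965, §2 Lemma 1–2] -/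
theorem finrank_antiSpan_sigmaType_eq_finrank_iSup_span_rightTranslates (Ψ : I → Set G) :
    Module.finrank ℚ (antiSpan G (sigmaType (E := fun _ : I => G) Ψ)) =
      Module.finrank ℚ (⨆ i, Submodule.span ℚ (Set.range fun δ : G => fun g : G => antiVec (Ψ i) (1 : G) (g * δ)) :
        Submodule ℚ (G → ℚ)) := by
  rw [finrank_antiSpan_sigmaType_eq_finrank_iSup_span_coeff]
  exact congrArg (fun p : Submodule ℚ (G → ℚ) => Module.finrank ℚ p)
    (iSup_congr fun i => span_coeff_eq_span_rightTranslates (Ψ i))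

/-- One free slot: `dim U(Ψ) = dim u·ℚ[G]` (left ideal versus right ideal generated by the type vector).
[cite: Ribet1980, §3 (3.3)] [cite: Kubota1965, §2 Lemma 1] -/
theorem finrank_antiSpan_eq_finrank_span_rightTranslates (Ψ : Set G) :
    Module.finrank ℚ (antiSpan G Ψ) =
      Module.finrank ℚ (Submodule.span ℚ (Set.range fun δ : G => fun g : G => antiVec Ψ (1 : G) (g * δ))) := by
  rw [finrank_antiSpan_eq_finrank_span_coeff, span_coeff_eq_span_rightTranslates]

omit [Fintype G] in
/-- The right translate of `u_1(Ψ)` by `δ`, read through `g ↦ g⁻¹`, is the (left) translate by `δ⁻¹` of the type vector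
of the INVERSE type `Ψ⁻¹ = {g⁻¹ : g ∈ Ψ}`: `u_1(Ψ)(g⁻¹δ) = u_{δ⁻¹}(Ψ⁻¹)(g)`. [cite: Ribet1980, §3 (3.3)] -/
theorem antiVec_one_inv_mul (Ψ : Set G) (δ g : G) :
    antiVec Ψ (1 : G) (g⁻¹ * δ) = antiVec Ψ⁻¹ δ⁻¹ g := by
  have hiff : (1 : G) • (g⁻¹ * δ) ∈ Ψ ↔ δ⁻¹ • g ∈ Ψ⁻¹ := by
    rw [one_smul, smul_eq_mul, Set.mem_inv, mul_inv_rev, inv_inv]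
  simp only [antiVec]
  by_cases hm : (1 : G) • (g⁻¹ * δ) ∈ Ψ
  · rw [translateInd_of_mem hm, translateInd_of_mem (hiff.1 hm)]
  · rw [translateInd_of_not_mem hm, translateInd_of_not_mem fun h' => hm (hiff.2 h')]

omit [Fintype G] in
/-- Inversion `g ↦ g⁻¹` carries the right ideal `u_1(Ψ)·ℚ[G]` onto the translate module `U(Ψ⁻¹)` of the inverse type.
[cite: Ribet1980, §3 (3.1)–(3.3)] -/
theorem map_inv_span_rightTranslates_eq_antiSpan_inv (Ψ : Set G) :
    Submodule.map ((LinearEquiv.funCongrLeft ℚ ℚ (Equiv.inv G) : (G → ℚ) ≃ₗ[ℚ] (G → ℚ)) : (G → ℚ) →ₗ[ℚ] (G → ℚ))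
        (Submodule.span ℚ (Set.range fun δ : G => fun g : G => antiVec Ψ (1 : G) (g * δ))) =
      antiSpan G Ψ⁻¹ := by
  have hι : ∀ (c : G → ℚ) (g : G), (LinearEquiv.funCongrLeft ℚ ℚ (Equiv.inv G) : (G → ℚ) ≃ₗ[ℚ] (G → ℚ)) c g =
      c g⁻¹ := fun c g => rfl
  rw [Submodule.map_span, ← Set.range_comp]
  unfold antiSpan
  congr 1
  ext v
  simp only [Set.mem_range, Function.comp_apply]
  constructor
  · rintro ⟨δ, rfl⟩
    exact ⟨δ⁻¹, funext fun g => by rw [LinearEquiv.coe_coe, hι, antiVec_one_inv_mul]⟩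
  · rintro ⟨δ, rfl⟩
    exact ⟨δ⁻¹, funext fun g => by rw [LinearEquiv.coe_coe, hι, antiVec_one_inv_mul, inv_inv]⟩

/-- **THE REFLEX READING: `dim Hg(∏_i A_i) = dim Σ_i U(Ψ_i⁻¹)`** — inversion `g ↦ g⁻¹` (a linear automorphism of
`ℚ^G`) carries the right ideal `u_iℚ[G]` onto the translate module of the INVERSE type `Ψ_i⁻¹` (for a Galois CM field:
the reflex type lifted to the field), so the rank of the family is read, inside the ONE slot `ℚ^G`, as the dimension of
the SUM of the translate modules of the inverse types; the family is additive iff these are independent.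
[cite: Ribet1980, §3 (3.1)–(3.3)] [cite: Deligne1982HodgeCycles, I.5 (p. 53)] -/
theorem finrank_antiSpan_sigmaType_eq_finrank_iSup_antiSpan_inv (Ψ : I → Set G) :
    Module.finrank ℚ (antiSpan G (sigmaType (E := fun _ : I => G) Ψ)) =
      Module.finrank ℚ (⨆ i, antiSpan G (Ψ i)⁻¹ : Submodule ℚ (G → ℚ)) := by
  rw [finrank_antiSpan_sigmaType_eq_finrank_iSup_span_rightTranslates,
    ← LinearEquiv.finrank_map_eq (LinearEquiv.funCongrLeft ℚ ℚ (Equiv.inv G) : (G → ℚ) ≃ₗ[ℚ] (G → ℚ))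
      (⨆ i, Submodule.span ℚ (Set.range fun δ : G => fun g : G => antiVec (Ψ i) (1 : G) (g * δ))),
    Submodule.map_iSup ((LinearEquiv.funCongrLeft ℚ ℚ (Equiv.inv G) : (G → ℚ) ≃ₗ[ℚ] (G → ℚ)) :
      (G → ℚ) →ₗ[ℚ] (G → ℚ))]
  exact congrArg (fun p : Submodule ℚ (G → ℚ) => Module.finrank ℚ p)
    (iSup_congr fun i => map_inv_span_rightTranslates_eq_antiSpan_inv (Ψ i))

/-- One free slot: `dim U(Ψ) = dim U(Ψ⁻¹)` — the rank of a type equals the rank of its inverse (reflex) type.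
[cite: Ribet1980, §3 (3.3)] -/
theorem finrank_antiSpan_eq_finrank_antiSpan_inv (Ψ : Set G) :
    Module.finrank ℚ (antiSpan G Ψ) = Module.finrank ℚ (antiSpan G Ψ⁻¹) := by
  rw [finrank_antiSpan_eq_finrank_span_rightTranslates,
    ← LinearEquiv.finrank_map_eq (LinearEquiv.funCongrLeft ℚ ℚ (Equiv.inv G) : (G → ℚ) ≃ₗ[ℚ] (G → ℚ))
      (Submodule.span ℚ (Set.range fun δ : G => fun g : G => antiVec Ψ (1 : G) (g * δ))),
    map_inv_span_rightTranslates_eq_antiSpan_inv]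

end Free

end Literature.NumberTheory.ComplexMultiplication.IrrOdd

end
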